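import Literature.NumberTheory.Automorphic.PairLFunctionPolesRepDataProofs
import Literature.NumberTheory.Automorphic.AutomorphicRepsGLAnalyticVectorsHolds
import Literature.NumberTheory.Automorphic.CuspFormsBoundedHC
import HarnessLib

/-!
# Arthur–Clozel (2.1)–(2.3) for Borel–Jacquet data from the realisation of clean cuspidal data in
# `L²_cusp` (proofs only)

Topic `NumberTheory/Automorphic`; namespace `Literature.NumberTheory.Automorphic`. Proof file
(theorems only: no definition, no named fact, no instance), sibling of `PairLFunctionPolesRepData`
and `PairLFunctionPolesRepDataProofs`, under the named facts
`JacquetShalika1981_multipliable_partialPairL_repData` (Arthur–Clozel, *Simple algebras, base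
change, and the advanced theory of the trace formula*, Ann. of Math. Stud. 120 (1989), Ch. 3 §2,
(2.1), p. 171 of the held copy: for unitary cuspidal `π`, `σ` "The Euler product `L^S` is absolutely
convergent for `Re s > 1`", Jacquet–Shalika I, Thm. (5.3)), `…_boundary_repData` ((2.2)) and
`…_pole_repData` ((2.3)), stated in the Borel–Jacquet model `CuspidalAutomorphicRepData`.

`PairLFunctionPolesRepData` proves the three facts from the `L²` leaves through the Borel–Jacquet
dictionary in the form `AutomorphicRepsGL.exists_isAssociatedL2` (association `W = W' ⊕ V_Π`) **and**
`hasSatakeParamAt_iff_L2` (agreement of the two notions of Satake parameter, both directions), plus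
clean models (`AutomorphicRepsGL.stable_cuspidal_eq_sSup_irreducible`). This file shows that the
dictionary is needed only in the weak form

* `AutomorphicRepsGL.exists_le_formsOfL2_of_W'_eq_bot hK μ` (`AutomorphicRepsGLIrreducibleL2`): an
  irreducible stable space `W₀` of `A_G`-invariant cusp forms lies in some `V_Π`,

and that the agreement of Satake parameters in the direction actually used (Borel–Jacquet → `L²`,
for clean data realised inside `V_Π`) is a **theorem**
(`CuspidalAutomorphicRepData.eq_of_hasSatakeParamAt_of_le_formsOfL2`): a `K(𝔫)`-invariant Hecke
eigenform `φ = invQuot f ∈ W₀ ≤ V_Π` gives the `K(𝔫)`-fixed vector `[f] ∈ Π`, on which the unramified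
Hecke algebra acts by the Satake scalars of `Π` (`heckeOperatorAt_eq_satake_smul`, Flath); the `L²`
eigen-equation is an a.e., hence (continuity, automorphic measures charge open sets) pointwise,
eigen-equation for `φ` (`invQuot` intertwines `R` with right translation, `invQuot_smul`), so the
eigenvalues, whence the multisets (`multiset_eq_of_esymm_eq`), agree. With
`hasSatakeParamAt_cofinite_holds` and `hasSatakeParamAt_unique_holds` (theorems of
`AutomorphicRepsGLSatakeFlathProofs`) this yields the unitary normalisation
`t_{π,w} = q_w^{s} t_{Π,w}` of a Borel–Jacquet datum with a clean model
(`CuspidalAutomorphicRepData.exists_satake_eq_cpow_mul_L2_of_le_formsOfL2`, Borel–Jacquet 1979, 5.7),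
and the three facts follow from their `L²` forms exactly as in the sibling files
(`…_of_normalisation`). Resulting dependence (`…_of_realisation_leaves`):

* (2.1) `JacquetShalika1981_multipliable_partialPairL_repData` ⟸ `exists_le_formsOfL2_of_W'_eq_bot`,
  `stable_cuspidal_eq_sSup_irreducible` ((2.1) in `L²` is the theorem
  `JacquetShalika1981_multipliable_partialPairL_holds`);
* (2.2) ⟸ the same two and the `L²` facts `JacquetShalika1981_partialPairL_at_one_of_ne_conj`,
  `…_boundary_of_ne_one`, `…_at_one_of_rank_ne`, `multiplicity_one_gl`;
* (2.3) ⟸ the same two and `JacquetShalika1981_partialPairL_pole_of_eq_conj` (through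
  `PairLFunctionPolesRepDataProofs`).

Since `exists_le_formsOfL2_of_W'_eq_bot` is itself reduced in the tree to boundedness of cusp forms
(the theorem `AutomorphicRepsGL.cuspidal_bounded_holds`, `CuspFormsBoundedHC`) and
`AutomorphicRepsGL.cuspidal_closure_exists_mem_l2OfForms`
(`AutomorphicRepsGL.exists_le_formsOfL2_of_W'_eq_bot_of_bounded_of_exists_mem`,
`AutomorphicRepsGLAnalyticVectorsHolds`), the `…_of_closure_leaves` corollaries put the three facts
on the base `{cuspidal_closure_exists_mem_l2OfForms, stable_cuspidal_eq_sSup_irreducible}` plus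
the `L²` facts.

## References

* J. Arthur, L. Clozel, *Simple algebras, base change, and the advanced theory of the trace
  formula*, Ann. of Math. Stud. 120 (1989), Ch. 3 §2, (2.1)–(2.3), p. 171. [ArthurClozelAMS120]
* H. Jacquet, J. A. Shalika, *On Euler products and the classification of automorphic
  representations I*, Amer. J. Math. 103 (1981), 499–558, (5.1) p. 554, Thm. (5.3).
  [JacquetShalikaAJM1981]
* H. Jacquet, J. A. Shalika, *On Euler products and the classification of automorphic forms II*,
  Amer. J. Math. 103 (1981), 777–815, Prop. 3.6. [JacquetShalikaAJM1981II]
* A. Borel, H. Jacquet, *Automorphic forms and automorphic representations*, Proc. Sympos. Pure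
  Math. 33 (1979), part 1, §4.6, 5.7. [BorelJacquetCorvallis1979]
* D. Flath, *Decomposition of representations into tensor products*, Corvallis 1979, Thm. 3.
  [FlathCorvallis1979]
-/

noncomputable section

open scoped MatrixGroups Topology Classical
open NumberField IsDedekindDomain MeasureTheory Filter

namespace Literature.NumberTheory.Automorphic

open AdelicGroupData

/-! ### The `L²` → pointwise Hecke bridge through `invQuot` -/

section Bridge

variable {n : ℕ} {K : Type} [Field K] [NumberField K]
  {μ : Measure (gl n K).automorphicQuotient}

/-- `toLp` of a finite sum of square-integrable functions is the sum of the classes. [folklore] -/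
theorem toLp_finset_sum_eq_sum_toLp {X : Type*} [MeasurableSpace X] {ν : Measure X} {ι : Type*}
    (s : Finset ι) {G : ι → X → ℂ} (hG : ∀ i, MemLp (G i) 2 ν) :
    (memLp_finsetSum' s fun i _ => hG i).toLp (∑ i ∈ s, G i) = ∑ i ∈ s, (hG i).toLp (G i) := by
  refine Lp.ext ?_
  have h3 : ∀ᵐ x ∂ν, ∀ i ∈ s, (((hG i).toLp (G i) : Lp ℂ 2 ν) : X → ℂ) x = G i x :=
    (Filter.eventually_all_finset s).2 fun i _ => (hG i).coeFn_toLp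
  filter_upwards [(memLp_finsetSum' s fun i _ => hG i).coeFn_toLp,
    Lp.coeFn_fun_finsetSum s (fun i => (hG i).toLp (G i)), h3] with x hx1 hx2 hx3
  rw [hx1, hx2, Finset.sum_apply]
  exact Finset.sum_congr rfl fun i hi => (hx3 i hi).symm

/-- `invQuot` is injective (every point of the quotient is some `[g⁻¹]`). [folklore] -/
theorem invQuot_injective_gl : Function.Injective (invQuot (gl n K)) := by
  intro f g h
  funext q
  obtain ⟨x, rfl⟩ := QuotientGroup.mk_surjective q
  have := congrFun h x⁻¹
  simp only [invQuot_apply, inv_inv] at this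
  exact this

/-- `invQuot` of a finite sum of translates: `invQuot (∑_x f (x⁻¹ • ·)) = ∑_x r(x) (invQuot f)`
(`invQuot_smul` summed). [folklore] -/
theorem invQuot_finset_sum_smul (s : Finset (gl n K).Adelic)
    (f : (gl n K).automorphicQuotient → ℂ) :
    invQuot (gl n K) (∑ x ∈ s, fun y => f (x⁻¹ • y)) =
      ∑ x ∈ s, rightTranslation (gl n K) x (invQuot (gl n K) f) := by
  funext z
  simp only [invQuot_apply, Finset.sum_apply]
  refine Finset.sum_congr rfl fun x _ => ?_
  have h := congrFun (invQuot_smul (gl n K) f x) z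
  simp only [invQuot_apply] at h
  exact h

variable [(gl n K).IsAutomorphicMeasure μ]

/-- The class `[f] ∈ Π` of a square-integrable `f` whose inversion `invQuot f` is right
`Kf`-invariant is a `Kf`-fixed vector of `Π` (`invQuot` intertwines `R` with right translation and
is injective). Borel–Jacquet 1979, 4.6. [cite: BorelJacquetCorvallis1979, 4.6] -/
theorem toLp_mem_fixedVectors_of_rightTranslation_invQuot_eq
    {P : ContRepresentation.ClosedSubrep ((gl n K).rightRegular μ)}
    {Kf : Subgroup (gl n K).Adelic} {f : (gl n K).automorphicQuotient → ℂ} (hf : MemLp f 2 μ)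
    (hfP : hf.toLp f ∈ P.toSubmodule)
    (hfix : ∀ u ∈ Kf, rightTranslation (gl n K) u (invQuot (gl n K) f) = invQuot (gl n K) f) :
    (⟨hf.toLp f, hfP⟩ : P.toSubmodule) ∈ P.fixedVectors Kf := by
  rw [ContRepresentation.ClosedSubrep.mem_fixedVectors]
  intro u hu
  apply Subtype.ext
  rw [ContRepresentation.ClosedSubrep.coe_toContRep_apply]
  change (gl n K).rightRegular μ u (hf.toLp f) = hf.toLp f
  rw [AdelicGroupData.rightRegular_apply, DomMulAct.mk_smul_toLp]
  have h : (fun x => f (u⁻¹ • x)) = f := by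
    refine invQuot_injective_gl ?_
    rw [invQuot_smul, hfix u hu]
  exact (MemLp.toLp_eq_toLp_iff _ hf).mpr (Filter.Eventually.of_forall fun x => congrFun h x)

/-- **The `L²` Hecke eigen-equation is a pointwise Hecke eigen-equation for the inverted
representative.** Let `Π` be a closed invariant subspace of `L²(GL_n(𝔸_K) ⧸ A_G GL_n(K), μ)`,
`f ∈ ℒ²(μ)` continuous with `[f] ∈ Π` and `invQuot f` right `Kf`-invariant, and `g` with a finite
double coset `Kf g Kf / Kf`. If `[Kf g Kf] [f] = c • [f]` in `Π`, then
`[Kf g Kf] (invQuot f) = c • invQuot f` as functions on `GL_n(𝔸_K)` (Hecke operator of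
`rightTranslation`): both operators are `∑_x ρ(x)` over one transversal
(`heckeOperator_apply_eq_sum`); `R(x) [f] = [f (x⁻¹ • ·)]` and `invQuot (f (x⁻¹ • ·)) = r(x) invQuot f`
(`invQuot_smul`); an a.e. identity of continuous functions is an identity, an automorphic measure
charging every non-empty open set. Borel–Jacquet 1979, 4.6 (the dictionary between `L²` and right
translation of automorphic forms). [cite: BorelJacquetCorvallis1979, 4.6] -/
theorem heckeOperator_invQuot_eq_smul_of_heckeOperatorAt_eq_smul
    {P : ContRepresentation.ClosedSubrep ((gl n K).rightRegular μ)}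
    {Kf : Subgroup (gl n K).Adelic} {g : (gl n K).Adelic}
    (hfin : (MulAction.orbit Kf (g : (gl n K).Adelic ⧸ Kf)).Finite)
    {f : (gl n K).automorphicQuotient → ℂ} (hf : MemLp f 2 μ) (hfP : hf.toLp f ∈ P.toSubmodule)
    (hcont : Continuous f)
    (hfix : ∀ u ∈ Kf, rightTranslation (gl n K) u (invQuot (gl n K) f) = invQuot (gl n K) f)
    {c : ℂ} (h : heckeOperatorAt P Kf g ⟨hf.toLp f, hfP⟩ = c • ⟨hf.toLp f, hfP⟩) :
    heckeOperator (rightTranslation (gl n K)) Kf g (invQuot (gl n K) f) =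
      c • invQuot (gl n K) f := by
  classical
  -- one transversal of `Kf g Kf / Kf` for both operators
  set s : Finset (gl n K).Adelic := hfin.toFinset.image Quotient.out with hs
  have hbij : Set.BijOn (fun x : (gl n K).Adelic => (x : (gl n K).Adelic ⧸ Kf)) s
      (MulAction.orbit Kf (g : (gl n K).Adelic ⧸ Kf)) := by
    refine ⟨?_, ?_, ?_⟩
    · intro x hx
      obtain ⟨y, hy, rfl⟩ := Finset.mem_image.1 hx
      rw [Set.Finite.mem_toFinset] at hy
      simpa only [QuotientGroup.out_eq'] using hy
    · intro x hx x' hx' hxx'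
      obtain ⟨y, -, rfl⟩ := Finset.mem_image.1 hx
      obtain ⟨y', -, rfl⟩ := Finset.mem_image.1 hx'
      simp only [QuotientGroup.out_eq'] at hxx'
      rw [hxx']
    · intro y hy
      refine ⟨y.out, Finset.mem_image.2 ⟨y, (Set.Finite.mem_toFinset _).2 hy, rfl⟩, ?_⟩
      exact QuotientGroup.out_eq' y
  -- the `L²` side as classes of functions
  have hFfix := toLp_mem_fixedVectors_of_rightTranslation_invQuot_eq hf hfP hfix
  have hL2 := h
  rw [heckeOperatorAt, heckeOperator_apply_eq_sum _ Kf g s hbij hFfix] at hL2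
  have hL2' := congrArg Subtype.val hL2
  rw [Submodule.coe_sum, Submodule.coe_smul] at hL2'
  have hG : ∀ x : (gl n K).Adelic, MemLp (fun y => f (x⁻¹ • y)) 2 μ := fun x =>
    hf.comp_measurePreserving (measurePreserving_smul x⁻¹ μ)
  have hsum : (∑ x ∈ s, (((ContRepresentation.toRepresentation ℂ (gl n K).Adelic P.toSubmodule
      P.toContRep) x ⟨hf.toLp f, hfP⟩ : P.toSubmodule) : (gl n K).L2 μ)) =
        ∑ x ∈ s, (hG x).toLp (fun y => f (x⁻¹ • y)) := by
    refine Finset.sum_congr rfl fun x _ => ?_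
    change (gl n K).rightRegular μ x (hf.toLp f) = _
    rw [AdelicGroupData.rightRegular_apply, DomMulAct.mk_smul_toLp]
  rw [hsum, ← toLp_finset_sum_eq_sum_toLp s hG, ← MemLp.toLp_const_smul c hf] at hL2'
  -- a.e. equality of continuous functions on the quotient
  have hae : (∑ x ∈ s, fun y => f (x⁻¹ • y)) =ᵐ[μ] c • f := (MemLp.toLp_eq_toLp_iff _ _).1 hL2'
  have hc1 : Continuous (∑ x ∈ s, fun y => f (x⁻¹ • y)) := by
    have : (∑ x ∈ s, fun y => f (x⁻¹ • y)) = fun y => ∑ x ∈ s, f (x⁻¹ • y) := by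
      funext y
      exact Finset.sum_apply y s _
    rw [this]
    exact continuous_finsetSum s fun x _ => hcont.comp (continuous_const_smul x⁻¹)
  have hc2 : Continuous (c • f) := hcont.const_smul c
  have heq : (∑ x ∈ s, fun y => f (x⁻¹ • y)) = c • f := Measure.eq_of_ae_eq hae hc1 hc2
  -- apply `invQuot`
  have hfun := congrArg (invQuot (gl n K)) heq
  rw [invQuot_finset_sum_smul] at hfun
  have hφfix : invQuot (gl n K) f ∈ (rightTranslation (gl n K)).fixedPoints Kf :=
    (Representation.mem_fixedPoints _ _ _).2 hfix
  rw [heckeOperator_apply_eq_sum _ Kf g s hbij hφfix, hfun]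
  rfl

variable {hcpt : isCompact_glFiniteIntegralLevel n K}

/-- Every element of `V_Π = formsOfL2 hcpt μ Π` is `invQuot f` for a square-integrable `f` with
`[f] ∈ Π`, and is continuous (generators are automorphic forms, continuous by
`IsAutomorphicForm.continuous_gl`; `invQuot` and `toLp` are linear). Borel–Jacquet 1979, 4.2 and 4.6.
(The statement `exists_toLp_mem_of_mem_formsOfL2` of `AutomorphicRepsGLCuspidalL2Step3`, re-proved to
keep the imports of this file inside the `L`-function corner.) [cite: BorelJacquetCorvallis1979, 4.2 and 4.6] -/
theorem exists_toLp_mem_of_mem_formsOfL2_gl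
    {P : ContRepresentation.ClosedSubrep ((gl n K).rightRegular μ)}
    {φ : (gl n K).Adelic → ℂ} (hφ : φ ∈ formsOfL2 hcpt μ P) :
    ∃ (f : (gl n K).automorphicQuotient → ℂ) (hf : MemLp f 2 μ),
      hf.toLp f ∈ P ∧ φ = invQuot (gl n K) f ∧ Continuous φ := by
  induction hφ using Submodule.span_induction with
  | mem φ h =>
    obtain ⟨f, hf, hP, rfl, hφ⟩ := h
    exact ⟨f, hf, hP, rfl, hφ.continuous_gl⟩
  | zero =>
    exact ⟨0, MemLp.zero, by rw [MemLp.toLp_zero]; exact P.toSubmodule.zero_mem, rfl,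
      continuous_const⟩
  | add φ ψ _ _ h₁ h₂ =>
    obtain ⟨f, hf, hfP, rfl, hcf⟩ := h₁
    obtain ⟨g, hg, hgP, rfl, hcg⟩ := h₂
    exact ⟨f + g, hf.add hg, by rw [MemLp.toLp_add hf hg]; exact P.toSubmodule.add_mem hfP hgP,
      rfl, hcf.add hcg⟩
  | smul c φ _ h =>
    obtain ⟨f, hf, hfP, rfl, hcf⟩ := h
    exact ⟨c • f, hf.const_smul c,
      by rw [MemLp.toLp_const_smul c hf]; exact P.toSubmodule.smul_mem c hfP, rfl,
      hcf.const_smul c⟩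

/-- **Agreement of Satake parameters, Borel–Jacquet → `L²`, for clean data realised in `V_Π`.**
Let `π = W₀ / ⊥` be a clean cuspidal Borel–Jacquet datum with `W₀ ≤ V_Π` for a cuspidal
`Π ⊂ L²_cusp(GL_n)`, `αP` a Satake family of `Π` off `S` (`IsSatakeFamilyOf`) and `w ∉ S`. Then every
Satake parameter `β` of `π` at `w` (Hecke eigenvalues of a `K(𝔫)`-invariant form `φ ∈ W₀ ∖ ⊥`,
`w ∤ 𝔫`) **is** `αP w`: `φ = invQuot f` with `[f] ∈ Π^{K(𝔫)}` non-zero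
(`exists_toLp_mem_of_mem_formsOfL2_gl`, `toLp_mem_fixedVectors_of_rightTranslation_invQuot_eq`), the
unramified Hecke operators `T_{w,i}` act on `Π^{K(𝔫)}` by the scalars `q_w^{i(n-i)/2} e_i(αP w)`
(`heckeOperatorAt_eq_satake_smul`: Flath's theorem and the spherical line), this `L²` identity is the
pointwise identity `T_{w,i} φ = q_w^{i(n-i)/2} e_i(αP w) φ`
(`heckeOperator_invQuot_eq_smul_of_heckeOperatorAt_eq_smul`, after matching uniformizers,
`heckeOperator_heckeDiagAt_eq_of_valuation_eq`), so `e_i(β) = e_i(αP w)` for `i ≤ n` and `β = αP w`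
(`multiset_eq_of_esymm_eq`). This is the direction of the named fact `hasSatakeParamAt_iff_L2` that the
`L`-function facts consume, in the clean case. Borel–Jacquet 1979, 4.6; Flath 1979, Thm. 3.
[cite: BorelJacquetCorvallis1979, 4.6] [cite: FlathCorvallis1979, Thm. 3] -/
theorem CuspidalAutomorphicRepData.eq_of_hasSatakeParamAt_of_le_formsOfL2
    {π : CuspidalAutomorphicRepData n K hcpt} (h0 : π.1.W' = ⊥)
    {P : CuspidalAutomorphicRepGL n K μ} (hle : π.1.W ≤ formsOfL2 hcpt μ P.1)
    {S : Set (HeightOneSpectrum (𝓞 K))} {αP : SatakeFamily K} (hαP : IsSatakeFamilyOf P S αP)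
    {w : HeightOneSpectrum (𝓞 K)} (hw : w ∉ S) {β : Multiset ℂ} (hβ : π.1.HasSatakeParamAt w β) :
    β = αP w := by
  obtain ⟨𝔫, ϖ, h𝔫, hw𝔫, hϖ, hcard, φ, hφW, hφW', hfix, hT⟩ := hβ
  rw [h0] at hφW' hT
  have hφ0 : φ ≠ 0 := fun h => hφW' (h ▸ Submodule.zero_mem _)
  obtain ⟨f, hf, hfP, hφf, hφc⟩ := exists_toLp_mem_of_mem_formsOfL2_gl (hle hφW)
  subst hφf
  have hfc : Continuous f := continuous_of_continuous_invQuot hφc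
  have hfP' : hf.toLp f ∈ P.1.toSubmodule := hfP
  have hFfix : (⟨hf.toLp f, hfP'⟩ : P.1.toSubmodule) ∈
      P.1.fixedVectors (principalCongruenceLevel n K 𝔫) :=
    toLp_mem_fixedVectors_of_rightTranslation_invQuot_eq hf hfP' hfix
  obtain ⟨ϖ', hϖ', hTP⟩ := heckeOperatorAt_eq_satake_smul P hαP h𝔫 hw hw𝔫 hFfix
  refine multiset_eq_of_esymm_eq (hcard.trans (hαP.card_eq hw).symm) fun j hj => ?_
  rw [hcard] at hj
  -- the `L²` eigen-equation for `T_{w,j}(ϖ')`, pointwise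
  have h1 := heckeOperator_invQuot_eq_smul_of_heckeOperatorAt_eq_smul
    (finite_orbit_heckeDiagAt h𝔫 hw𝔫 hϖ' j) hf hfP' hfc hfix (hTP j hj)
  -- the Borel–Jacquet eigen-equation for `T_{w,j}(ϖ)`, i.e. for `T_{w,j}(ϖ')`
  have h2 : heckeOperator (rightTranslation (gl n K)) (principalCongruenceLevel n K 𝔫)
      (heckeDiagAt n K w ϖ' j) (invQuot (gl n K) f) =
        ((((Real.sqrt (w.residueCard : ℝ)) : ℝ) : ℂ) ^ (j * (n - j)) * β.esymm j) •
          invQuot (gl n K) f := by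
    have hop : heckeOperator (rightTranslation (gl n K)) (principalCongruenceLevel n K 𝔫)
        (heckeDiagAt n K w ϖ' j) = heckeOperator (rightTranslation (gl n K))
          (principalCongruenceLevel n K 𝔫) (heckeDiagAt n K w ϖ j) :=
      heckeOperator_heckeDiagAt_eq_of_valuation_eq _
        (isMaximalAt_principalCongruenceLevel n K w h𝔫 hw𝔫) (hϖ'.trans hϖ.symm) j
    rw [hop]
    have h := hT j hj
    rw [Submodule.mem_bot, sub_eq_zero] at h
    exact h
  have h3 : ((((Real.sqrt (w.residueCard : ℝ)) : ℝ) : ℂ) ^ (j * (n - j)) * (αP w).esymm j) •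
      invQuot (gl n K) f =
        ((((Real.sqrt (w.residueCard : ℝ)) : ℝ) : ℂ) ^ (j * (n - j)) * β.esymm j) •
          invQuot (gl n K) f := h1.symm.trans h2
  have h4 := smul_left_injective ℂ hφ0 h3
  exact (mul_left_cancel₀ (pow_ne_zero _ (sqrt_residueCard_ne_zero (K := K) w)) h4).symm

end Bridge

/-! ### The unitary normalisation of a Borel–Jacquet datum from the realisation fact -/

section Normalisation

open Literature.NumberTheory.GaloisRepresentations (HeckeCharacter ideleGroup)

variable {n : ℕ} {K : Type} [Field K] [NumberField K] {hcpt : isCompact_glFiniteIntegralLevel n K}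

/-- **"We may assume `π` unitary" from the realisation of clean data in `L²_cusp`** (the statement of
`CuspidalAutomorphicRepData.exists_satake_eq_cpow_mul_L2_of_clean`, `LanglandsTetrahedralProofs`, with
its dictionary inputs `exists_isAssociatedL2`, `hasSatakeParamAt_iff_L2` replaced by the single
realisation fact `AutomorphicRepsGL.exists_le_formsOfL2_of_W'_eq_bot hcpt μ`). For a cuspidal
Borel–Jacquet datum `π` on `GL_n(𝔸_K)` (`n ≥ 1`) having the Satake parameters of a clean datum `π₀`
(`W₀' = ⊥`) there are `s ∈ ℂ`, a cuspidal `Π ⊂ L²_cusp(GL_n(K) A_G \ GL_n(𝔸_K))` and a Satake family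
`α_Π` of `Π` off a finite `S` with `t_{π,w} = q_w^{s} α_Π(w)` exactly, for `w ∉ S`. Proof: `A_G` acts
on `W₀` by `a ↦ a^μ` (`exists_apply_posRealScalar_mul_eq_cpow`); the twist `W₁ = W₀ ⊗ |det|^{s₀}`,
`s₀ = -μ / (n [K:ℚ])`, is an `A_G`-invariant clean cuspidal datum, so `W₁ ≤ V_Π` for some cuspidal
`Π` (the realisation fact); off the finite set where `Π` has no Satake family
(`exists_isSatakeFamilyOf_holds`) or `π₁` is ramified (`hasSatakeParamAt_cofinite_holds`) the
Satake parameters of `π₁` are those of `Π` (`eq_of_hasSatakeParamAt_of_le_formsOfL2`); untwist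
(`HasSatakeParamAt.of_map_mulChar_detTwist_of_cpow`) and use uniqueness
(`hasSatakeParamAt_unique_holds`). Borel–Jacquet 1979, 5.7; Arthur–Clozel, proof of Thm. 3.1
("We may assume `π`, `π'` unitary"). [cite: BorelJacquetCorvallis1979, 5.7] -/
theorem CuspidalAutomorphicRepData.exists_satake_eq_cpow_mul_L2_of_le_formsOfL2 [NeZero n]
    {μm : Measure (gl n K).automorphicQuotient} [(gl n K).IsAutomorphicMeasure μm]
    (hre : AutomorphicRepsGL.exists_le_formsOfL2_of_W'_eq_bot hcpt μm)
    (π π₀ : CuspidalAutomorphicRepData n K hcpt) (h0W' : π₀.1.W' = ⊥)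
    (h0π : ∀ (v : HeightOneSpectrum (𝓞 K)) (β : Multiset ℂ),
      π₀.1.HasSatakeParamAt v β → π.1.HasSatakeParamAt v β) :
    ∃ (s : ℂ) (P : CuspidalAutomorphicRepGL n K μm) (S : Set (HeightOneSpectrum (𝓞 K)))
      (αP : SatakeFamily K), S.Finite ∧ IsSatakeFamilyOf P S αP ∧
      ∀ w ∉ S, ∀ β : Multiset ℂ,
        π.1.HasSatakeParamAt w β ↔ β = (αP w).map (((w.residueCard : ℂ) ^ s) * ·) := by
  classical
  obtain ⟨μ, hμ⟩ := π₀.1.exists_apply_posRealScalar_mul_eq_cpow h0W'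
  -- the normalising exponent `s₀ = -μ / (n [K:ℚ])` and the character `|·|^{s₀}`
  have hnd : ((n * Module.finrank ℚ K : ℕ) : ℂ) ≠ 0 := by
    exact_mod_cast (Nat.mul_ne_zero (NeZero.ne n) Module.finrank_pos.ne')
  set s₀ : ℂ := -μ / (n * Module.finrank ℚ K : ℕ) with hs₀
  have hs : s₀ * (n * Module.finrank ℚ K : ℕ) = -μ := by rw [hs₀, div_mul_cancel₀ _ hnd]
  obtain ⟨χ, hχ⟩ := exists_heckeCharacter_ideleNorm_cpow K s₀
  -- the twisted datum `π₁ = π₀ ⊗ |det|^{s₀}`, `A_G`-invariant and clean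
  obtain ⟨π₁, h1W, h1W'⟩ := exists_cuspidalAutomorphicRepData_map_mulChar_detTwist hχ π₀
  have hAG : ∀ φ ∈ π₁.1.W, ∀ z ∈ (gl n K).center', ∀ g, φ (z * g) = φ g := by
    intro φ hφ z hz g
    rw [h1W] at hφ
    obtain ⟨φ₀, hφ₀, rfl⟩ := hφ
    obtain ⟨t, rfl⟩ := hz
    exact mulChar_detTwist_apply_posRealScalar_mul_of_cpow hχ hs (hμ φ₀ hφ₀) t g
  have h1bot : π₁.1.W' = ⊥ := by rw [h1W', h0W', Submodule.map_bot]
  -- realise `π₁` in `L²`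
  obtain ⟨P, hP⟩ := hre π₁ h1bot hAG
  obtain ⟨S, αP, -, hαP⟩ := exists_isSatakeFamilyOf_holds (n := n) (K := K) (μ := μm) P
  -- the finite set where `π₁` is ramified
  set E : Set (HeightOneSpectrum (𝓞 K)) := {v | ¬ π₁.1.IsUnramifiedAt v} with hE
  have hEfin : E.Finite :=
    Filter.eventually_cofinite.1 (AutomorphicRepData.hasSatakeParamAt_cofinite_holds π₁.1)
  refine ⟨s₀, P, (↑S : Set (HeightOneSpectrum (𝓞 K))) ∪ E, αP, S.finite_toSet.union hEfin,
    hαP.mono Set.subset_union_left, fun w hw β => ?_⟩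
  have hwS : w ∉ (↑S : Set (HeightOneSpectrum (𝓞 K))) := fun h => hw (Or.inl h)
  have hwE : π₁.1.IsUnramifiedAt w := by
    by_contra h
    exact hw (Or.inr h)
  obtain ⟨β₁, hβ₁⟩ := hwE
  have h1 : π₁.1.HasSatakeParamAt w (αP w) := by
    rw [← CuspidalAutomorphicRepData.eq_of_hasSatakeParamAt_of_le_formsOfL2 h1bot hP hαP hwS hβ₁]
    exact hβ₁
  have h0W : π₀.1.W = π₁.1.W.map (mulChar (detTwist n χ⁻¹)) := by
    rw [h1W, detTwist_inv, map_mulChar_inv_map_mulChar]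
  have h0W'' : π₀.1.W' = π₁.1.W'.map (mulChar (detTwist n χ⁻¹)) := by
    rw [h1W', h0W', Submodule.map_bot, Submodule.map_bot]
  have h0 : π₀.1.HasSatakeParamAt w ((αP w).map (((w.residueCard : ℂ) ^ s₀) * ·)) := by
    have := AutomorphicRepData.HasSatakeParamAt.of_map_mulChar_detTwist_of_cpow
      (inv_apply_of_cpow hχ) h0W h0W'' h1
    rwa [neg_neg] at this
  have hπ : π.1.HasSatakeParamAt w ((αP w).map (((w.residueCard : ℂ) ^ s₀) * ·)) := h0π w _ h0
  exact ⟨fun hβ => AutomorphicRepData.hasSatakeParamAt_unique_holds π.1 hβ hπ, fun hβ => hβ ▸ hπ⟩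

end Normalisation

/-! ### The three facts from a unitary normalisation -/

section OfNormalisation

variable {n m : ℕ} {F : Type} [Field F] [NumberField F]
  {hF : isCompact_glFiniteIntegralLevel n F} {hF' : isCompact_glFiniteIntegralLevel m F}

/-- **The unitary normalisation of a pair** from per-datum normalisations (as
`CuspidalAutomorphicRepData.exists_pair_satake_eq_cpow_mul_L2`, union of the exceptional sets): if
`π` on `GL_n` and `σ` on `GL_m` have normalisations `t_π = q^{s₁} t_{π₀}`, `t_σ = q^{s₂} t_{σ₀}` off
finite sets, they have them off one finite `S₀`. [cite: BorelJacquetCorvallis1979, 5.7] -/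
theorem CuspidalAutomorphicRepData.exists_pair_satake_eq_cpow_mul_of_normalisation
    {μ : Measure (gl n F).automorphicQuotient} [(gl n F).IsAutomorphicMeasure μ]
    {μ' : Measure (gl m F).automorphicQuotient} [(gl m F).IsAutomorphicMeasure μ']
    {π : CuspidalAutomorphicRepData n F hF} {π' : CuspidalAutomorphicRepData m F hF'}
    (hπ : ∃ (s : ℂ) (P : CuspidalAutomorphicRepGL n F μ) (S : Set (HeightOneSpectrum (𝓞 F)))
      (αP : SatakeFamily F), S.Finite ∧ IsSatakeFamilyOf P S αP ∧
      ∀ w ∉ S, ∀ β : Multiset ℂ,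
        π.1.HasSatakeParamAt w β ↔ β = (αP w).map (((w.residueCard : ℂ) ^ s) * ·))
    (hπ' : ∃ (s : ℂ) (P : CuspidalAutomorphicRepGL m F μ') (S : Set (HeightOneSpectrum (𝓞 F)))
      (αP : SatakeFamily F), S.Finite ∧ IsSatakeFamilyOf P S αP ∧
      ∀ w ∉ S, ∀ β : Multiset ℂ,
        π'.1.HasSatakeParamAt w β ↔ β = (αP w).map (((w.residueCard : ℂ) ^ s) * ·)) :
    ∃ (s₁ s₂ : ℂ) (P : CuspidalAutomorphicRepGL n F μ) (P' : CuspidalAutomorphicRepGL m F μ')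
      (S₀ : Set (HeightOneSpectrum (𝓞 F))) (αP αP' : SatakeFamily F),
      S₀.Finite ∧ IsSatakeFamilyOf P S₀ αP ∧ IsSatakeFamilyOf P' S₀ αP' ∧
      (∀ w ∉ S₀, ∀ β : Multiset ℂ,
        π.1.HasSatakeParamAt w β ↔ β = (αP w).map (((w.residueCard : ℂ) ^ s₁) * ·)) ∧
      (∀ w ∉ S₀, ∀ β : Multiset ℂ,
        π'.1.HasSatakeParamAt w β ↔ β = (αP' w).map (((w.residueCard : ℂ) ^ s₂) * ·)) := by
  obtain ⟨s₁, P, S, αP, hS, hαP, hiff⟩ := hπ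
  obtain ⟨s₂, P', S', αP', hS', hαP', hiff'⟩ := hπ'
  exact ⟨s₁, s₂, P, P', S ∪ S', αP, αP', hS.union hS', hαP.mono Set.subset_union_left,
    hαP'.mono Set.subset_union_right, fun w hw β => hiff w (fun h => hw (Or.inl h)) β,
    fun w hw β => hiff' w (fun h => hw (Or.inr h)) β⟩

/-- **(2.1) for Borel–Jacquet data from unitary normalisations.** If every cuspidal Borel–Jacquet
datum `π` on `GL_n(𝔸_K)` (`n ≥ 1`, any number field, any automorphic measure) has a unitary
normalisation `t_{π,w} = q_w^{s} t_{Π,w}` off a finite set with `Π ⊂ L²_cusp` (hypothesis `hN`; in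
print Borel–Jacquet 1979, 5.7), then `JacquetShalika1981_multipliable_partialPairL_repData` holds:
this is the proof of `JacquetShalika1981_multipliable_partialPairL_repData_of_L2` verbatim
(unitarity of the families forces `re s₁ = re s₂ = 0`, the Euler factors of `(π, σ)` at `s` are those
of `(Π, Σ)` at `s - s₁ - s₂`, and (2.1) in `L²` is the theorem
`JacquetShalika1981_multipliable_partialPairL_holds`).
[cite: ArthurClozelAMS120, Ch. 3 §2 (2.1)] [cite: JacquetShalikaAJM1981, Thm. (5.3)] -/
theorem JacquetShalika1981_multipliable_partialPairL_repData_of_normalisation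
    (hN : ∀ {n : ℕ} {K : Type} [Field K] [NumberField K] (hK : isCompact_glFiniteIntegralLevel n K)
      [NeZero n] (μ : Measure (gl n K).automorphicQuotient) [(gl n K).IsAutomorphicMeasure μ]
      (π : CuspidalAutomorphicRepData n K hK),
      ∃ (s : ℂ) (P : CuspidalAutomorphicRepGL n K μ) (S : Set (HeightOneSpectrum (𝓞 K)))
        (αP : SatakeFamily K), S.Finite ∧ IsSatakeFamilyOf P S αP ∧
        ∀ w ∉ S, ∀ β : Multiset ℂ,
          π.1.HasSatakeParamAt w β ↔ β = (αP w).map (((w.residueCard : ℂ) ^ s) * ·)) :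
    JacquetShalika1981_multipliable_partialPairL_repData := by
  intro n m F _ _ hF hF' hn hm π π'
  haveI : NeZero n := ⟨hn.ne'⟩
  haveI : NeZero m := ⟨hm.ne'⟩
  obtain ⟨μ, hμ⟩ := AdelicGroupData.exists_isAutomorphicMeasure_gl_holds n F
  obtain ⟨μ', hμ'⟩ := AdelicGroupData.exists_isAutomorphicMeasure_gl_holds m F
  haveI := hμ
  haveI := hμ'
  obtain ⟨s₁, s₂, P, P', S₀, αP, αP', hS₀, hαP, hαP', hiff, hiff'⟩ :=
    CuspidalAutomorphicRepData.exists_pair_satake_eq_cpow_mul_of_normalisation (hN hF μ π)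
      (hN hF' μ' π')
  refine ⟨S₀, hS₀, ?_⟩
  intro S hS hS₀S α β hα hβ hu hu' s hs
  have hαe := eq_map_cpow_mul_of_hasSatakeParamAt hS₀S hiff hα
  have hβe := eq_map_cpow_mul_of_hasSatakeParamAt hS₀S hiff' hβ
  haveI := infinite_heightOneSpectrum F
  obtain ⟨w₀, hw₀⟩ := hS.infinite_compl.nonempty
  have hs₁ : s₁.re = 0 :=
    re_eq_zero_of_norm_prod_eq_one_of_shift (hαP.mono hS₀S) hn hw₀ (hαe w₀ hw₀) (hu w₀ hw₀)
  have hs₂ : s₂.re = 0 :=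
    re_eq_zero_of_norm_prod_eq_one_of_shift (hαP'.mono hS₀S) hm hw₀ (hβe w₀ hw₀) (hu' w₀ hw₀)
  rw [pairEulerFactor_eq_of_shift hαe hβe s]
  refine JacquetShalika1981_multipliable_partialPairL_holds P P' (hαP.mono hS₀S) (hαP'.mono hS₀S) ?_
  rwa [Complex.sub_re, Complex.add_re, hs₁, hs₂, add_zero, sub_zero]

/-- **(2.2) for Borel–Jacquet data from unitary normalisations.** Granting, for all `GL_n` over all
number fields and all automorphic measures, the `L²` facts (2.2) at `s₀ = 1` for `π ≇ σ̃` (`h22`), on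
`Re s = 1` off `1` (`h22'`) and at `s₀ = 1` for `n ≠ m` (`hrk`), multiplicity one (`hm1`) and unitary
normalisations of cuspidal Borel–Jacquet data (`hN`), the fact
`JacquetShalika1981_partialPairL_boundary_repData` holds: the proof of
`JacquetShalika1981_partialPairL_boundary_repData_of_L2` verbatim (for `n = m` both data are
normalised in ONE `L²_cusp`, so that "`s₀ ∈ X`" becomes `Π = Σ̄`).
[cite: ArthurClozelAMS120, Ch. 3 §2 (2.2)] [cite: JacquetShalikaAJM1981II, Prop. 3.6] -/
theorem JacquetShalika1981_partialPairL_boundary_repData_of_normalisation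
    (h22 : ∀ {n : ℕ} {K : Type} [Field K] [NumberField K] {μ : Measure (gl n K).automorphicQuotient}
      [(gl n K).IsAutomorphicMeasure μ],
      JacquetShalika1981_partialPairL_at_one_of_ne_conj (n := n) (K := K) (μ := μ))
    (h22' : ∀ {n m : ℕ} {K : Type} [Field K] [NumberField K]
      {μ : Measure (gl n K).automorphicQuotient} [(gl n K).IsAutomorphicMeasure μ]
      {μ' : Measure (gl m K).automorphicQuotient} [(gl m K).IsAutomorphicMeasure μ'],
      JacquetShalika1981_partialPairL_boundary_of_ne_one (n := n) (m := m) (K := K) (μ := μ)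
        (μ' := μ'))
    (hrk : ∀ {n m : ℕ} {K : Type} [Field K] [NumberField K]
      {μ : Measure (gl n K).automorphicQuotient} [(gl n K).IsAutomorphicMeasure μ]
      {μ' : Measure (gl m K).automorphicQuotient} [(gl m K).IsAutomorphicMeasure μ'],
      JacquetShalika1981_partialPairL_at_one_of_rank_ne (n := n) (m := m) (K := K) (μ := μ)
        (μ' := μ'))
    (hm1 : ∀ (n : ℕ) (K : Type) [Field K] [NumberField K] (μ : Measure (gl n K).automorphicQuotient)
      [(gl n K).IsAutomorphicMeasure μ], multiplicity_one_gl n K μ)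
    (hN : ∀ {n : ℕ} {K : Type} [Field K] [NumberField K] (hK : isCompact_glFiniteIntegralLevel n K)
      [NeZero n] (μ : Measure (gl n K).automorphicQuotient) [(gl n K).IsAutomorphicMeasure μ]
      (π : CuspidalAutomorphicRepData n K hK),
      ∃ (s : ℂ) (P : CuspidalAutomorphicRepGL n K μ) (S : Set (HeightOneSpectrum (𝓞 K)))
        (αP : SatakeFamily K), S.Finite ∧ IsSatakeFamilyOf P S αP ∧
        ∀ w ∉ S, ∀ β : Multiset ℂ,
          π.1.HasSatakeParamAt w β ↔ β = (αP w).map (((w.residueCard : ℂ) ^ s) * ·)) :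
    JacquetShalika1981_partialPairL_boundary_repData := by
  intro n m F _ _ hF hF' hn hm π π'
  haveI : NeZero n := ⟨hn.ne'⟩
  haveI : NeZero m := ⟨hm.ne'⟩
  haveI := infinite_heightOneSpectrum F
  by_cases hnm : n = m
  · -- equal ranks: one automorphic measure for both
    subst hnm
    obtain ⟨μ, hμ⟩ := AdelicGroupData.exists_isAutomorphicMeasure_gl_holds n F
    haveI := hμ
    obtain ⟨s₁, s₂, P, P', S₀, αP, αP', hS₀, hαP, hαP', hiff, hiff'⟩ :=
      CuspidalAutomorphicRepData.exists_pair_satake_eq_cpow_mul_of_normalisation (hN hF μ π)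
        (hN hF' μ π')
    refine ⟨S₀, hS₀, ?_⟩
    intro S hS hS₀S α β hα hβ hu hu' s₀ hs₀ hX
    have hαe := eq_map_cpow_mul_of_hasSatakeParamAt hS₀S hiff hα
    have hβe := eq_map_cpow_mul_of_hasSatakeParamAt hS₀S hiff' hβ
    obtain ⟨w₀, hw₀⟩ := hS.infinite_compl.nonempty
    have hs₁ : s₁.re = 0 :=
      re_eq_zero_of_norm_prod_eq_one_of_shift (hαP.mono hS₀S) hn hw₀ (hαe w₀ hw₀) (hu w₀ hw₀)
    have hs₂ : s₂.re = 0 :=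
      re_eq_zero_of_norm_prod_eq_one_of_shift (hαP'.mono hS₀S) hn hw₀ (hβe w₀ hw₀) (hu' w₀ hw₀)
    have hz : (s₁ + s₂).re = 0 := by rw [Complex.add_re, hs₁, hs₂, add_zero]
    have hre : (s₀ - (s₁ + s₂)).re = 1 := by rw [Complex.sub_re, hz, sub_zero, hs₀]
    by_cases h1 : s₀ - (s₁ + s₂) = 1
    · -- `s₀ - s₁ - s₂ = 1`: `π₀ ≠ σ̄₀`, else `s₀ ∈ X`
      have hne : P ≠ P'.conj := by
        intro heq
        apply hX
        refine ⟨rfl, ?_⟩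
        have hconj : IsSatakeFamilyOf P S fun v => (αP' v).map (starRingEnd ℂ) := by
          rw [heq]
          exact (hαP'.mono hS₀S).conj
        have hnotS : ∀ᶠ w : HeightOneSpectrum (𝓞 F) in cofinite, w ∉ S := by
          rw [Filter.eventually_cofinite]
          simpa using hS
        filter_upwards [hnotS] with w hw
        have hq : w.residueCard ≠ 0 := by have := w.one_lt_residueCard; omega
        rw [hαe w hw, hβe w hw, map_cpow_mul_map_cpow_mul_eq_map_inv_map_cpow_mul_iff hq,
          (hαP'.mono hS₀S).map_inv_eq_map_conj hw, (hαP.mono hS₀S).eq_of_not_mem hconj hw hw]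
        have h0 : 1 - s₀ + (s₁ + s₂) = 0 := by linear_combination (-1 : ℂ) * h1
        rw [h0, Complex.cpow_zero]
        simp only [one_mul, Multiset.map_id']
      obtain ⟨c, hc, hlim⟩ := h22 hn (hm1 n F μ) P P' hne hS (hαP.mono hS₀S) (hαP'.mono hS₀S)
      refine ⟨c, hc, tendsto_partialPairL_of_shift' hαe hβe hz ?_⟩
      rwa [h1]
    · obtain ⟨c, hc, hlim⟩ := h22' hn hn P P' hS (hαP.mono hS₀S) (hαP'.mono hS₀S) hre h1
      exact ⟨c, hc, tendsto_partialPairL_of_shift' hαe hβe hz hlim⟩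
  · -- different ranks: `X = ∅`
    obtain ⟨μ, hμ⟩ := AdelicGroupData.exists_isAutomorphicMeasure_gl_holds n F
    obtain ⟨μ', hμ'⟩ := AdelicGroupData.exists_isAutomorphicMeasure_gl_holds m F
    haveI := hμ
    haveI := hμ'
    obtain ⟨s₁, s₂, P, P', S₀, αP, αP', hS₀, hαP, hαP', hiff, hiff'⟩ :=
      CuspidalAutomorphicRepData.exists_pair_satake_eq_cpow_mul_of_normalisation (hN hF μ π)
        (hN hF' μ' π')
    refine ⟨S₀, hS₀, ?_⟩
    intro S hS hS₀S α β hα hβ hu hu' s₀ hs₀ _hX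
    have hαe := eq_map_cpow_mul_of_hasSatakeParamAt hS₀S hiff hα
    have hβe := eq_map_cpow_mul_of_hasSatakeParamAt hS₀S hiff' hβ
    obtain ⟨w₀, hw₀⟩ := hS.infinite_compl.nonempty
    have hs₁ : s₁.re = 0 :=
      re_eq_zero_of_norm_prod_eq_one_of_shift (hαP.mono hS₀S) hn hw₀ (hαe w₀ hw₀) (hu w₀ hw₀)
    have hs₂ : s₂.re = 0 :=
      re_eq_zero_of_norm_prod_eq_one_of_shift (hαP'.mono hS₀S) hm hw₀ (hβe w₀ hw₀) (hu' w₀ hw₀)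
    have hz : (s₁ + s₂).re = 0 := by rw [Complex.add_re, hs₁, hs₂, add_zero]
    have hre : (s₀ - (s₁ + s₂)).re = 1 := by rw [Complex.sub_re, hz, sub_zero, hs₀]
    by_cases h1 : s₀ - (s₁ + s₂) = 1
    · obtain ⟨c, hc, hlim⟩ := hrk hnm hn hm P P' hS (hαP.mono hS₀S) (hαP'.mono hS₀S)
      refine ⟨c, hc, tendsto_partialPairL_of_shift' hαe hβe hz ?_⟩
      rwa [h1]
    · obtain ⟨c, hc, hlim⟩ := h22' hn hm P P' hS (hαP.mono hS₀S) (hαP'.mono hS₀S) hre h1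
      exact ⟨c, hc, tendsto_partialPairL_of_shift' hαe hβe hz hlim⟩

/-- **(2.3) for Borel–Jacquet data from unitary normalisations.** Granting, for all `GL_n` over all
number fields and all automorphic measures, the `L²` fact (2.3) (`h23`) and unitary normalisations
of cuspidal Borel–Jacquet data (`hN`), the fact `JacquetShalika1981_partialPairL_pole_repData`
holds: the proof of `JacquetShalika1981_partialPairL_pole_repData_of_L2'`
(`PairLFunctionPolesRepDataProofs`) verbatim — direct shift off `T = S ∪ E`, change of `S` through
the strict bound from (2.3) (`norm_lt_sqrt_of_pole_of_eq_conj`) and (5.1.3)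
(`norm_satakeParameter_le_sqrt_holds`).
[cite: ArthurClozelAMS120, Ch. 3 §2 (2.3)] [cite: JacquetShalikaAJM1981II, Prop. 3.6]
[cite: JacquetShalikaAJM1981, (5.1) p. 554 and Cor. (2.5)] -/
theorem JacquetShalika1981_partialPairL_pole_repData_of_normalisation
    (h23 : ∀ {n : ℕ} {K : Type} [Field K] [NumberField K] {μ : Measure (gl n K).automorphicQuotient}
      [(gl n K).IsAutomorphicMeasure μ],
      JacquetShalika1981_partialPairL_pole_of_eq_conj (n := n) (K := K) (μ := μ))
    (hN : ∀ {n : ℕ} {K : Type} [Field K] [NumberField K] (hK : isCompact_glFiniteIntegralLevel n K)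
      [NeZero n] (μ : Measure (gl n K).automorphicQuotient) [(gl n K).IsAutomorphicMeasure μ]
      (π : CuspidalAutomorphicRepData n K hK),
      ∃ (s : ℂ) (P : CuspidalAutomorphicRepGL n K μ) (S : Set (HeightOneSpectrum (𝓞 K)))
        (αP : SatakeFamily K), S.Finite ∧ IsSatakeFamilyOf P S αP ∧
        ∀ w ∉ S, ∀ β : Multiset ℂ,
          π.1.HasSatakeParamAt w β ↔ β = (αP w).map (((w.residueCard : ℂ) ^ s) * ·)) :
    JacquetShalika1981_partialPairL_pole_repData := by
  intro n F _ _ hF hn π π'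
  haveI : NeZero n := ⟨hn.ne'⟩
  haveI := infinite_heightOneSpectrum F
  obtain ⟨μ, hμ⟩ := AdelicGroupData.exists_isAutomorphicMeasure_gl_holds n F
  haveI := hμ
  obtain ⟨s₁, s₂, P, P', S₀, αP, αP', hS₀, hαP, hαP', hiff, hiff'⟩ :=
    CuspidalAutomorphicRepData.exists_pair_satake_eq_cpow_mul_of_normalisation (hN hF μ π)
      (hN hF μ π')
  refine ⟨S₀, hS₀, ?_⟩
  intro S hS hS₀S α β hα hβ hu hu' s₀ hs₀ hX
  have hαe := eq_map_cpow_mul_of_hasSatakeParamAt hS₀S hiff hα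
  have hβe := eq_map_cpow_mul_of_hasSatakeParamAt hS₀S hiff' hβ
  obtain ⟨w₀, hw₀⟩ := hS.infinite_compl.nonempty
  have hs₁ : s₁.re = 0 :=
    re_eq_zero_of_norm_prod_eq_one_of_shift (hαP.mono hS₀S) hn hw₀ (hαe w₀ hw₀) (hu w₀ hw₀)
  have hs₂ : s₂.re = 0 :=
    re_eq_zero_of_norm_prod_eq_one_of_shift (hαP'.mono hS₀S) hn hw₀ (hβe w₀ hw₀) (hu' w₀ hw₀)
  have hz : (s₁ + s₂).re = 0 := by rw [Complex.add_re, hs₁, hs₂, add_zero]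
  -- the finite exceptional set of `s₀ ∈ X`, and the relation off `T = S ∪ E` in `L²` terms
  set E : Set (HeightOneSpectrum (𝓞 F)) :=
    {w | ¬ ((α w).map (((w.residueCard : ℂ) ^ (1 - s₀)) * ·) = (β w).map (·⁻¹))} with hE
  have hEfin : E.Finite := Filter.eventually_cofinite.1 hX
  set T : Set (HeightOneSpectrum (𝓞 F)) := S ∪ E with hT
  have hTfin : T.Finite := hS.union hEfin
  have hST : S ⊆ T := Set.subset_union_left
  have hS₀T : S₀ ⊆ T := hS₀S.trans hST
  set u : ℂ := 1 - s₀ + (s₁ + s₂) with hudef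
  have hu0 : u.re = 0 := by
    rw [hudef, Complex.add_re, Complex.sub_re, Complex.one_re, hs₀, hz, sub_self, add_zero]
  have hrel : ∀ w ∉ T,
      (αP w).map (((w.residueCard : ℂ) ^ u) * ·) = (αP' w).map (starRingEnd ℂ) := by
    intro w hw
    have hwS : w ∉ S := fun h => hw (hST h)
    have hwE : (α w).map (((w.residueCard : ℂ) ^ (1 - s₀)) * ·) = (β w).map (·⁻¹) := by
      by_contra h
      exact hw (Or.inr h)
    have hq : w.residueCard ≠ 0 := by have := w.one_lt_residueCard; omega
    rw [hαe w hwS, hβe w hwS, map_cpow_mul_map_cpow_mul_eq_map_inv_map_cpow_mul_iff hq,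
      (hαP'.mono hS₀S).map_inv_eq_map_conj hwS] at hwE
    exact hwE
  -- off `T`: `t_π = q^{s₁} t_{π₀}` and `t_σ = q^{s₂ - u} \bar t_{π₀}`
  have hαT : ∀ w ∉ T, α w = (αP w).map (((w.residueCard : ℂ) ^ s₁) * ·) :=
    fun w hw => hαe w (fun h => hw (hST h))
  have hγ : IsSatakeFamilyOf P.conj S₀ fun w => (αP w).map (starRingEnd ℂ) := hαP.conj
  have hβT : ∀ w ∉ T, β w =
      ((fun w => (αP w).map (starRingEnd ℂ)) w).map (((w.residueCard : ℂ) ^ (s₂ - u)) * ·) := by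
    intro w hw
    have hwS : w ∉ S := fun h => hw (hST h)
    have hq' : (w.residueCard : ℂ) ≠ 0 := by
      exact_mod_cast (zero_lt_one.trans w.one_lt_residueCard).ne'
    have h1 : αP' w = ((αP w).map (((w.residueCard : ℂ) ^ u) * ·)).map (starRingEnd ℂ) := by
      rw [hrel w hw, Multiset.map_map, Function.comp_def]
      simp only [Complex.conj_conj, Multiset.map_id']
    rw [hβe w hwS, h1]
    simp only [Multiset.map_map, Function.comp_def, map_mul]
    refine Multiset.map_congr rfl fun a _ => ?_
    rw [conj_natCast_cpow_of_re_eq_zero hu0, ← mul_assoc, ← Complex.cpow_add _ _ hq',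
      ← sub_eq_add_neg]
  -- the pole of `L^T(·, π₀ ⊗ π̄₀)` at `1` ((2.3) in `L²`) is a pole of `L^T(·, π ⊗ σ)` at `s₀`
  have hz' : (s₁ + (s₂ - u)).re = 0 := by
    rw [Complex.add_re, Complex.sub_re, hs₁, hs₂, hu0]
    ring
  have hs₀' : s₀ - (s₁ + (s₂ - u)) = 1 := by
    rw [hudef]
    ring
  obtain ⟨c, hc, hlim⟩ :=
    h23 hn P P.conj P.conj_conj.symm hTfin (hαP.mono hS₀T) (hγ.mono hS₀T)
  have hTlim : Tendsto (fun s => (s - s₀) * partialPairL T α β s) (𝓝[{s : ℂ | 1 < s.re}] s₀)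
      (𝓝 c) := by
    refine tendsto_sub_mul_partialPairL_of_shift hαT hβT hz' ?_
    rw [hs₀']
    exact hlim
  -- descend from `T` to `S`
  refine exists_ne_zero_tendsto_mul_partialPairL_of_subset hST (hEfin.subset ?_) (fun s => s - s₀)
    ?_ ?_ ⟨c, hc, hTlim⟩
  · rintro w ⟨hwT | hwE, hwS⟩
    · exact absurd hwT hwS
    · exact hwE
  · -- multipliability over `v ∉ T` for `Re s > 1`: (2.1) for `(π₀, σ₀)` after the shift
    filter_upwards [self_mem_nhdsWithin] with s hs
    have hβT' : ∀ w ∉ T, β w = (αP' w).map (((w.residueCard : ℂ) ^ s₂) * ·) :=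
      fun w hw => hβe w (fun h => hw (hST h))
    rw [pairEulerFactor_eq_of_shift hαT hβT' s]
    refine JacquetShalika1981_multipliable_partialPairL_holds P P' (hαP.mono hS₀T) (hαP'.mono hS₀T) ?_
    rw [Complex.sub_re, hz, sub_zero]
    exact hs
  · -- the moved factors are non-zero at `s₀`: strict bound for `π₀`, (5.1.3) for `σ₀`
    rintro w ⟨-, hwS⟩
    have hwS₀ : w ∉ S₀ := fun h => hwS (hS₀S h)
    have hq : w.residueCard ≠ 0 := by have := w.one_lt_residueCard; omega
    rw [hαe w hwS, hβe w hwS, eval_satakePairPolynomial_map_mul_map_mul,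
      natCast_cpow_mul_cpow_mul_cpow_neg _ hq]
    refine eval_satakePairPolynomial_ne_zero_of_lt_sqrt w.one_lt_residueCard
      (fun a ha => norm_lt_sqrt_of_pole_of_eq_conj h23 hn P hS₀ hαP hwS₀ ha)
      (fun b hb => norm_satakeParameter_le_sqrt_holds P' hαP' hwS₀ hb) ?_
    rw [Complex.sub_re, hz, sub_zero, hs₀]

end OfNormalisation

/-! ### The three facts on the base `{exists_le_formsOfL2_of_W'_eq_bot, stable_cuspidal_eq_sSup_irreducible}` -/

section OfRealisation

/-- **Unitary normalisations of all cuspidal Borel–Jacquet data from the realisation fact and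
semisimplicity.** Granting, for all `GL_n` over all number fields and all automorphic measures,
`AutomorphicRepsGL.exists_le_formsOfL2_of_W'_eq_bot` (`hre`) and clean models (`hcl`; supplied by
`AutomorphicRepsGL.stable_cuspidal_eq_sSup_irreducible` through
`CuspidalAutomorphicRepData.exists_clean_hasSatakeParamAt_of_sSup_irreducible`), every cuspidal
Borel–Jacquet datum has a unitary normalisation
(`CuspidalAutomorphicRepData.exists_satake_eq_cpow_mul_L2_of_le_formsOfL2`).
[cite: BorelJacquetCorvallis1979, 5.7] -/
theorem CuspidalAutomorphicRepData.exists_satake_eq_cpow_mul_L2_of_realisation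
    (hre : ∀ {n : ℕ} {K : Type} [Field K] [NumberField K] (hK : isCompact_glFiniteIntegralLevel n K)
      (μ : Measure (gl n K).automorphicQuotient) [(gl n K).IsAutomorphicMeasure μ],
      AutomorphicRepsGL.exists_le_formsOfL2_of_W'_eq_bot hK μ)
    (hcl : ∀ {n : ℕ} {K : Type} [Field K] [NumberField K] (hK : isCompact_glFiniteIntegralLevel n K)
      [NeZero n] (π : CuspidalAutomorphicRepData n K hK), ∃ π₀ : CuspidalAutomorphicRepData n K hK,
        π₀.1.W' = ⊥ ∧ ∀ (v : HeightOneSpectrum (𝓞 K)) (β : Multiset ℂ),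
          π₀.1.HasSatakeParamAt v β → π.1.HasSatakeParamAt v β)
    {n : ℕ} {K : Type} [Field K] [NumberField K] (hK : isCompact_glFiniteIntegralLevel n K)
    [NeZero n] (μ : Measure (gl n K).automorphicQuotient) [(gl n K).IsAutomorphicMeasure μ]
    (π : CuspidalAutomorphicRepData n K hK) :
    ∃ (s : ℂ) (P : CuspidalAutomorphicRepGL n K μ) (S : Set (HeightOneSpectrum (𝓞 K)))
      (αP : SatakeFamily K), S.Finite ∧ IsSatakeFamilyOf P S αP ∧
      ∀ w ∉ S, ∀ β : Multiset ℂ,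
        π.1.HasSatakeParamAt w β ↔ β = (αP w).map (((w.residueCard : ℂ) ^ s) * ·) := by
  obtain ⟨π₀, h0, h0π⟩ := hcl hK π
  exact CuspidalAutomorphicRepData.exists_satake_eq_cpow_mul_L2_of_le_formsOfL2 (hre hK μ) π π₀ h0 h0π

/-- **(2.1) for Borel–Jacquet data on the base `{exists_le_formsOfL2_of_W'_eq_bot,
stable_cuspidal_eq_sSup_irreducible}`**: the fact `JacquetShalika1981_multipliable_partialPairL_repData`
follows from the discharges of `AutomorphicRepsGL.exists_le_formsOfL2_of_W'_eq_bot` and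
`AutomorphicRepsGL.stable_cuspidal_eq_sSup_irreducible` alone ((2.1) in `L²` being the theorem
`JacquetShalika1981_multipliable_partialPairL_holds`). [cite: ArthurClozelAMS120, Ch. 3 §2 (2.1)]
[cite: JacquetShalikaAJM1981, Thm. (5.3)] -/
theorem JacquetShalika1981_multipliable_partialPairL_repData_of_realisation_leaves
    (hre : ∀ {n : ℕ} {K : Type} [Field K] [NumberField K] (hK : isCompact_glFiniteIntegralLevel n K)
      (μ : Measure (gl n K).automorphicQuotient) [(gl n K).IsAutomorphicMeasure μ],
      AutomorphicRepsGL.exists_le_formsOfL2_of_W'_eq_bot hK μ)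
    (hss : ∀ {n : ℕ} {K : Type} [Field K] [NumberField K] (hK : isCompact_glFiniteIntegralLevel n K),
      AutomorphicRepsGL.stable_cuspidal_eq_sSup_irreducible hK) :
    JacquetShalika1981_multipliable_partialPairL_repData :=
  JacquetShalika1981_multipliable_partialPairL_repData_of_normalisation fun hK _ μ _ π =>
    CuspidalAutomorphicRepData.exists_satake_eq_cpow_mul_L2_of_realisation hre (fun hK _ π =>
      CuspidalAutomorphicRepData.exists_clean_hasSatakeParamAt_of_sSup_irreducible (hss hK) π) hK μ π

/-- **(2.2) for Borel–Jacquet data on the base `{…_at_one_of_ne_conj, …_boundary_of_ne_one,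
…_at_one_of_rank_ne, multiplicity_one_gl, exists_le_formsOfL2_of_W'_eq_bot,
stable_cuspidal_eq_sSup_irreducible}`**. [cite: ArthurClozelAMS120, Ch. 3 §2 (2.2)] -/
theorem JacquetShalika1981_partialPairL_boundary_repData_of_realisation_leaves
    (h22 : ∀ {n : ℕ} {K : Type} [Field K] [NumberField K] {μ : Measure (gl n K).automorphicQuotient}
      [(gl n K).IsAutomorphicMeasure μ],
      JacquetShalika1981_partialPairL_at_one_of_ne_conj (n := n) (K := K) (μ := μ))
    (h22' : ∀ {n m : ℕ} {K : Type} [Field K] [NumberField K]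
      {μ : Measure (gl n K).automorphicQuotient} [(gl n K).IsAutomorphicMeasure μ]
      {μ' : Measure (gl m K).automorphicQuotient} [(gl m K).IsAutomorphicMeasure μ'],
      JacquetShalika1981_partialPairL_boundary_of_ne_one (n := n) (m := m) (K := K) (μ := μ)
        (μ' := μ'))
    (hrk : ∀ {n m : ℕ} {K : Type} [Field K] [NumberField K]
      {μ : Measure (gl n K).automorphicQuotient} [(gl n K).IsAutomorphicMeasure μ]
      {μ' : Measure (gl m K).automorphicQuotient} [(gl m K).IsAutomorphicMeasure μ'],
      JacquetShalika1981_partialPairL_at_one_of_rank_ne (n := n) (m := m) (K := K) (μ := μ)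
        (μ' := μ'))
    (hm1 : ∀ (n : ℕ) (K : Type) [Field K] [NumberField K] (μ : Measure (gl n K).automorphicQuotient)
      [(gl n K).IsAutomorphicMeasure μ], multiplicity_one_gl n K μ)
    (hre : ∀ {n : ℕ} {K : Type} [Field K] [NumberField K] (hK : isCompact_glFiniteIntegralLevel n K)
      (μ : Measure (gl n K).automorphicQuotient) [(gl n K).IsAutomorphicMeasure μ],
      AutomorphicRepsGL.exists_le_formsOfL2_of_W'_eq_bot hK μ)
    (hss : ∀ {n : ℕ} {K : Type} [Field K] [NumberField K] (hK : isCompact_glFiniteIntegralLevel n K),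
      AutomorphicRepsGL.stable_cuspidal_eq_sSup_irreducible hK) :
    JacquetShalika1981_partialPairL_boundary_repData :=
  JacquetShalika1981_partialPairL_boundary_repData_of_normalisation h22 h22' hrk hm1
    fun hK _ μ _ π =>
      CuspidalAutomorphicRepData.exists_satake_eq_cpow_mul_L2_of_realisation hre (fun hK _ π =>
        CuspidalAutomorphicRepData.exists_clean_hasSatakeParamAt_of_sSup_irreducible (hss hK) π) hK μ π

/-- **(2.3) for Borel–Jacquet data on the base `{…_pole_of_eq_conj, exists_le_formsOfL2_of_W'_eq_bot,
stable_cuspidal_eq_sSup_irreducible}`** (three leaves). [cite: ArthurClozelAMS120, Ch. 3 §2 (2.3)] -/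
theorem JacquetShalika1981_partialPairL_pole_repData_of_realisation_leaves
    (h23 : ∀ {n : ℕ} {K : Type} [Field K] [NumberField K] {μ : Measure (gl n K).automorphicQuotient}
      [(gl n K).IsAutomorphicMeasure μ],
      JacquetShalika1981_partialPairL_pole_of_eq_conj (n := n) (K := K) (μ := μ))
    (hre : ∀ {n : ℕ} {K : Type} [Field K] [NumberField K] (hK : isCompact_glFiniteIntegralLevel n K)
      (μ : Measure (gl n K).automorphicQuotient) [(gl n K).IsAutomorphicMeasure μ],
      AutomorphicRepsGL.exists_le_formsOfL2_of_W'_eq_bot hK μ)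
    (hss : ∀ {n : ℕ} {K : Type} [Field K] [NumberField K] (hK : isCompact_glFiniteIntegralLevel n K),
      AutomorphicRepsGL.stable_cuspidal_eq_sSup_irreducible hK) :
    JacquetShalika1981_partialPairL_pole_repData :=
  JacquetShalika1981_partialPairL_pole_repData_of_normalisation h23 fun hK _ μ _ π =>
    CuspidalAutomorphicRepData.exists_satake_eq_cpow_mul_L2_of_realisation hre (fun hK _ π =>
      CuspidalAutomorphicRepData.exists_clean_hasSatakeParamAt_of_sSup_irreducible (hss hK) π) hK μ π

end OfRealisation

/-! ### The same on the base `{cuspidal_closure_exists_mem_l2OfForms, stable_cuspidal_eq_sSup_irreducible}` -/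

section OfClosure

/-- **The realisation fact from Harish-Chandra's density half alone**: since cusp forms on `GL_n` are
bounded (the theorem `AutomorphicRepsGL.cuspidal_bounded_holds`, `CuspFormsBoundedHC`),
`AutomorphicRepsGL.exists_le_formsOfL2_of_W'_eq_bot hK μ` follows from
`AutomorphicRepsGL.cuspidal_closure_exists_mem_l2OfForms hK μ`
(`AutomorphicRepsGL.exists_le_formsOfL2_of_W'_eq_bot_of_bounded_of_exists_mem`).
[cite: BorelJacquetCorvallis1979, 4.6] [cite: HarishChandraTAMS1953, Thm. 5 (pp. 228–229)] -/
theorem AutomorphicRepsGL.exists_le_formsOfL2_of_W'_eq_bot_of_closure_exists_mem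
    {n : ℕ} {K : Type} [Field K] [NumberField K] (hK : isCompact_glFiniteIntegralLevel n K)
    (μ : Measure (gl n K).automorphicQuotient) [(gl n K).IsAutomorphicMeasure μ]
    (h₃ : AutomorphicRepsGL.cuspidal_closure_exists_mem_l2OfForms hK μ) :
    AutomorphicRepsGL.exists_le_formsOfL2_of_W'_eq_bot hK μ :=
  AutomorphicRepsGL.exists_le_formsOfL2_of_W'_eq_bot_of_bounded_of_exists_mem
    AutomorphicRepsGL.cuspidal_bounded_holds h₃

/-- **(2.1) for Borel–Jacquet data on the base `{cuspidal_closure_exists_mem_l2OfForms,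
stable_cuspidal_eq_sSup_irreducible}`**: `JacquetShalika1981_multipliable_partialPairL_repData`
follows from the discharges of `AutomorphicRepsGL.cuspidal_closure_exists_mem_l2OfForms` and
`AutomorphicRepsGL.stable_cuspidal_eq_sSup_irreducible` alone.
[cite: ArthurClozelAMS120, Ch. 3 §2 (2.1)] [cite: JacquetShalikaAJM1981, Thm. (5.3)] -/
theorem JacquetShalika1981_multipliable_partialPairL_repData_of_closure_leaves
    (h₃ : ∀ {n : ℕ} {K : Type} [Field K] [NumberField K] (hK : isCompact_glFiniteIntegralLevel n K)
      (μ : Measure (gl n K).automorphicQuotient) [(gl n K).IsAutomorphicMeasure μ],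
      AutomorphicRepsGL.cuspidal_closure_exists_mem_l2OfForms hK μ)
    (hss : ∀ {n : ℕ} {K : Type} [Field K] [NumberField K] (hK : isCompact_glFiniteIntegralLevel n K),
      AutomorphicRepsGL.stable_cuspidal_eq_sSup_irreducible hK) :
    JacquetShalika1981_multipliable_partialPairL_repData :=
  JacquetShalika1981_multipliable_partialPairL_repData_of_realisation_leaves
    (fun hK μ _ => AutomorphicRepsGL.exists_le_formsOfL2_of_W'_eq_bot_of_closure_exists_mem hK μ
      (h₃ hK μ)) hss

/-- **(2.2) for Borel–Jacquet data on the base `{…_at_one_of_ne_conj, …_boundary_of_ne_one,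
…_at_one_of_rank_ne, multiplicity_one_gl, cuspidal_closure_exists_mem_l2OfForms,
stable_cuspidal_eq_sSup_irreducible}`**. [cite: ArthurClozelAMS120, Ch. 3 §2 (2.2)] -/
theorem JacquetShalika1981_partialPairL_boundary_repData_of_closure_leaves
    (h22 : ∀ {n : ℕ} {K : Type} [Field K] [NumberField K] {μ : Measure (gl n K).automorphicQuotient}
      [(gl n K).IsAutomorphicMeasure μ],
      JacquetShalika1981_partialPairL_at_one_of_ne_conj (n := n) (K := K) (μ := μ))
    (h22' : ∀ {n m : ℕ} {K : Type} [Field K] [NumberField K]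
      {μ : Measure (gl n K).automorphicQuotient} [(gl n K).IsAutomorphicMeasure μ]
      {μ' : Measure (gl m K).automorphicQuotient} [(gl m K).IsAutomorphicMeasure μ'],
      JacquetShalika1981_partialPairL_boundary_of_ne_one (n := n) (m := m) (K := K) (μ := μ)
        (μ' := μ'))
    (hrk : ∀ {n m : ℕ} {K : Type} [Field K] [NumberField K]
      {μ : Measure (gl n K).automorphicQuotient} [(gl n K).IsAutomorphicMeasure μ]
      {μ' : Measure (gl m K).automorphicQuotient} [(gl m K).IsAutomorphicMeasure μ'],
      JacquetShalika1981_partialPairL_at_one_of_rank_ne (n := n) (m := m) (K := K) (μ := μ)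
        (μ' := μ'))
    (hm1 : ∀ (n : ℕ) (K : Type) [Field K] [NumberField K] (μ : Measure (gl n K).automorphicQuotient)
      [(gl n K).IsAutomorphicMeasure μ], multiplicity_one_gl n K μ)
    (h₃ : ∀ {n : ℕ} {K : Type} [Field K] [NumberField K] (hK : isCompact_glFiniteIntegralLevel n K)
      (μ : Measure (gl n K).automorphicQuotient) [(gl n K).IsAutomorphicMeasure μ],
      AutomorphicRepsGL.cuspidal_closure_exists_mem_l2OfForms hK μ)
    (hss : ∀ {n : ℕ} {K : Type} [Field K] [NumberField K] (hK : isCompact_glFiniteIntegralLevel n K),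
      AutomorphicRepsGL.stable_cuspidal_eq_sSup_irreducible hK) :
    JacquetShalika1981_partialPairL_boundary_repData :=
  JacquetShalika1981_partialPairL_boundary_repData_of_realisation_leaves h22 h22' hrk hm1
    (fun hK μ _ => AutomorphicRepsGL.exists_le_formsOfL2_of_W'_eq_bot_of_closure_exists_mem hK μ
      (h₃ hK μ)) hss

/-- **(2.3) for Borel–Jacquet data on the base `{…_pole_of_eq_conj,
cuspidal_closure_exists_mem_l2OfForms, stable_cuspidal_eq_sSup_irreducible}`**.
[cite: ArthurClozelAMS120, Ch. 3 §2 (2.3)] -/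
theorem JacquetShalika1981_partialPairL_pole_repData_of_closure_leaves
    (h23 : ∀ {n : ℕ} {K : Type} [Field K] [NumberField K] {μ : Measure (gl n K).automorphicQuotient}
      [(gl n K).IsAutomorphicMeasure μ],
      JacquetShalika1981_partialPairL_pole_of_eq_conj (n := n) (K := K) (μ := μ))
    (h₃ : ∀ {n : ℕ} {K : Type} [Field K] [NumberField K] (hK : isCompact_glFiniteIntegralLevel n K)
      (μ : Measure (gl n K).automorphicQuotient) [(gl n K).IsAutomorphicMeasure μ],
      AutomorphicRepsGL.cuspidal_closure_exists_mem_l2OfForms hK μ)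
    (hss : ∀ {n : ℕ} {K : Type} [Field K] [NumberField K] (hK : isCompact_glFiniteIntegralLevel n K),
      AutomorphicRepsGL.stable_cuspidal_eq_sSup_irreducible hK) :
    JacquetShalika1981_partialPairL_pole_repData :=
  JacquetShalika1981_partialPairL_pole_repData_of_realisation_leaves h23
    (fun hK μ _ => AutomorphicRepsGL.exists_le_formsOfL2_of_W'_eq_bot_of_closure_exists_mem hK μ
      (h₃ hK μ)) hss

end OfClosure

end Literature.NumberTheory.Automorphic

end
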